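import Summits.AtomisticToContinuum.Crystallization.Theorems.ChargedEnergyGap.Negative.BlocksLocal
import Summits.AtomisticToContinuum.Crystallization.Theorems.ChargedEnergyGap.Negative.PeriodicForm

/-!
# `ChargedEnergyGap` (stmt-AtomisticToContinuum-14231), negative side VII: the crux implies the periodic form

Converse of part V: `NoBoundary η κ → PeriodicPricing η κ` (`0 ≤ η ≤ 1`, `κ ≥ 0`), hence
**`chargedEnergyGap_iff_periodicPricing : ChargedEnergyGap ↔ ∃ κ > 0, PeriodicPricing (1/100) κ`**
— the crux is EXACTLY the statement that every periodic configuration pays `κ` per charged motif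
site above `e*`.  Proof: apply the allowance-free gap to the blocks of part BlocksEnergy; by part
BlocksLocal, `lvl3`-deep block points are charged in the block iff their motif point is charged in
`Q`; non-deep points are `≤ 6·lvl3·K²`; blocks are trial states (`Blocks.exists_block_energy_le`).
All `[folklore]`.
-/

noncomputable section

namespace Summit.AtomisticToContinuum.Crystallization.Theorems.ChargedEnergyGapNegative

open Literature.MathematicalPhysics.StatisticalMechanics
open Literature.Geometry.DiscreteGeometry
open Summit.AtomisticToContinuum.Crystallization.Theses.PricedLinkCensus
open scoped BigOperators

namespace Blocks

variable (Q : PeriodicConfiguration 3)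

variable (K : ℕ)

/-! ### Counting charged block points -/

/-- Charge in `Q` is the same at all block points over the same motif point. [folklore] -/
theorem isChargeFree_toP_iff_motif (η : ℝ) (u : BIdx Q K) :
    IsChargeFree η (ptConfig Q) (toP Q K u) ↔
      IsChargeFree η (ptConfig Q) ⟨u.1.1, Q.mem_points_of_mem_motif u.1.2⟩ := by
  have h : toP Q K u = transl Q (latVec_mem Q (coords K u.2))
      ⟨u.1.1, Q.mem_points_of_mem_motif u.1.2⟩ := Subtype.ext rfl
  rw [h, isChargeFree_transl]

/-- The number of block points (indexed by `BIdx`) that are charged in the BLOCK. [folklore] -/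
theorem card_charged_block_ge {η : ℝ} (hη0 : 0 ≤ η) (hη1 : η ≤ 1) :
    Nat.card {k : Fin 3 → Fin K // IsDeep K (lvl3 Q) k} * motifCharged η Q ≤
      Nat.card {u : BIdx Q K // ¬ IsChargeFree η (bpt Q K) u} := by
  classical
  -- the deep block points whose motif point is charged in `Q` inject into the charged block points
  let f : {k : Fin 3 → Fin K // IsDeep K (lvl3 Q) k} ×
      {x : Q.motif // ¬ IsChargeFree η (ptConfig Q) ⟨x.1, Q.mem_points_of_mem_motif x.2⟩} →
      {u : BIdx Q K // ¬ IsChargeFree η (bpt Q K) u} :=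
    fun p => ⟨(p.2.1, p.1.1), by
      rw [isChargeFree_block_iff Q K hη0 hη1 (u := (p.2.1, p.1.1)) p.1.2, isChargeFree_toP_iff_motif]
      exact p.2.2⟩
  have hf : Function.Injective f := by
    rintro ⟨⟨k, hk⟩, ⟨x, hx⟩⟩ ⟨⟨k', hk'⟩, ⟨x', hx'⟩⟩ h
    have h' := congrArg (fun w => w.1) h
    simp only [f] at h'
    obtain ⟨rfl, rfl⟩ := Prod.ext_iff.1 h'
    rfl
  have := Nat.card_le_card_of_injective f hf
  rw [Nat.card_prod] at this
  unfold motifCharged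
  exact this

/-- The block configuration (indexed by `Fin (#F K³)`) has as many charged sites as the block
indexed by `BIdx`. [folklore] -/
theorem charged_blockConfig_eq (η : ℝ) :
    charged η (blockConfig Q K) = Nat.card {u : BIdx Q K // ¬ IsChargeFree η (bpt Q K) u} := by
  unfold charged
  refine Nat.card_congr ((Fintype.equivFin (BIdx Q K)).symm.subtypeEquiv fun a => ?_)
  rw [blockConfig, isChargeFree_comp_equiv_iff]

/-- At least `K³ − 6·lvl3·K²` lattice coordinates are `lvl3`-deep. [folklore] -/
theorem card_deep_ge (d : ℕ) :
    K ^ 3 ≤ Nat.card {k : Fin 3 → Fin K // IsDeep K d k} + 6 * d * K ^ 2 := by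
  classical
  have h1 : Nat.card {k : Fin 3 → Fin K // IsDeep K d k} =
      (Finset.univ.filter fun k : Fin 3 → Fin K => IsDeep K d k).card := by
    rw [Nat.card_eq_fintype_card, Fintype.card_subtype]
  have h2 := Finset.card_filter_add_card_filter_not
    (s := (Finset.univ : Finset (Fin 3 → Fin K))) (fun k => IsDeep K d k)
  have h3 : (Finset.univ : Finset (Fin 3 → Fin K)).card = K ^ 3 := by
    rw [Finset.card_univ, Fintype.card_fun, Fintype.card_fin, Fintype.card_fin]
  have h4 := card_not_deep_le K d
  omega

/-! ### The crux implies the periodic pricing -/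

/-- **`NoBoundary η κ → PeriodicPricing η κ`** (`0 ≤ η ≤ 1`, `κ ≥ 0`). [folklore] -/
theorem periodicPricing_of_noBoundary {η κ : ℝ} (hη0 : 0 ≤ η) (hη1 : η ≤ 1) (hκ : 0 ≤ κ)
    (h : NoBoundary η κ) : PeriodicPricing η κ := by
  intro Q
  by_contra hlt
  push Not at hlt
  have hF : (0 : ℝ) < Q.motif.card := by exact_mod_cast Q.motif_nonempty.card_pos
  set δ := κ * (motifCharged η Q : ℝ) -
    (Q.motif.card : ℝ) * (Q.energyPerParticle lennardJones - eStar) with hδ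
  have hδ0 : 0 < δ := by rw [hδ]; linarith
  -- blocks are trial states with slack `δ / (3 #F)` per particle
  obtain ⟨K₀, hK₀, hK⟩ := exists_block_energy_le Q (show 0 < δ / (3 * Q.motif.card) by positivity)
  -- a large `K`: beyond `K₀`, beyond `6·lvl3`, and with `6·lvl3·κ·mC ≤ (δ/3)·K`
  obtain ⟨K₁, hK₁⟩ := exists_nat_gt (18 * (lvl3 Q) * κ * (motifCharged η Q) / δ)
  set K := max K₀ (max (6 * lvl3 Q) (K₁ + 1)) with hKdef
  have hKK₀ : K₀ ≤ K := le_max_left _ _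
  have hK6 : 6 * lvl3 Q ≤ K := (le_max_left _ _).trans (le_max_right _ _)
  have hKK₁ : K₁ + 1 ≤ K := (le_max_right _ _).trans (le_max_right _ _)
  have hKpos : (0 : ℝ) < K := by exact_mod_cast lt_of_lt_of_le hK₀ hKK₀
  have hK1r : (K₁ : ℝ) + 1 ≤ K := by exact_mod_cast hKK₁
  -- the allowance-free gap on the block
  have hgap := h _ (blockConfig Q K) (blockConfig_injective Q K)
  rw [charged_blockConfig_eq] at hgap
  have hn : ((Fintype.card (BIdx Q K) : ℕ) : ℝ) = Q.motif.card * (K : ℝ) ^ 3 := by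
    exact_mod_cast card_BIdx Q K
  rw [hn] at hgap
  have hE := hK K hKK₀
  rw [hn] at hE
  -- charged block points: at least `(K³ − 6·lvl3·K²)·mC`
  have hch := card_charged_block_ge Q K hη0 hη1 (η := η)
  have hdeep := card_deep_ge K (lvl3 Q)
  have hchR : ((K : ℝ) ^ 3 - 6 * (lvl3 Q) * (K : ℝ) ^ 2) * (motifCharged η Q : ℝ) ≤
      (Nat.card {u : BIdx Q K // ¬ IsChargeFree η (bpt Q K) u} : ℝ) := by
    have h1 : ((K : ℝ) ^ 3 - 6 * (lvl3 Q) * (K : ℝ) ^ 2) ≤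
        (Nat.card {k : Fin 3 → Fin K // IsDeep K (lvl3 Q) k} : ℝ) := by
      have := (Nat.cast_le (α := ℝ)).2 hdeep; push_cast at this ⊢; linarith
    have h2 : ((Nat.card {k : Fin 3 → Fin K // IsDeep K (lvl3 Q) k} : ℕ) : ℝ) *
        (motifCharged η Q : ℝ) ≤ (Nat.card {u : BIdx Q K // ¬ IsChargeFree η (bpt Q K) u} : ℝ) := by
      exact_mod_cast hch
    nlinarith [Nat.cast_nonneg (α := ℝ) (motifCharged η Q)]
  -- `6·lvl3·κ·mC·K² ≤ (δ/3)·K³`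
  have hsmall : 6 * (lvl3 Q) * κ * (motifCharged η Q : ℝ) * (K : ℝ) ^ 2 ≤ δ / 3 * (K : ℝ) ^ 3 := by
    have h1 : 18 * (lvl3 Q) * κ * (motifCharged η Q : ℝ) / δ < K := by linarith
    rw [div_lt_iff₀ hδ0] at h1
    have hK2 : (0 : ℝ) ≤ (K : ℝ) ^ 2 := by positivity
    nlinarith
  -- combine: `κ·(K³ − 6LK²)·mC ≤ κ·#charged ≤ E − n e* ≤ n(e − e*) + n·δ/(3F)`
  have hmono : κ * (((K : ℝ) ^ 3 - 6 * (lvl3 Q) * (K : ℝ) ^ 2) * (motifCharged η Q : ℝ)) ≤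
      κ * (Nat.card {u : BIdx Q K // ¬ IsChargeFree η (bpt Q K) u} : ℝ) :=
    mul_le_mul_of_nonneg_left hchR hκ
  have hK3 : (0 : ℝ) < (K : ℝ) ^ 3 := by positivity
  have key : (K : ℝ) ^ 3 * (κ * (motifCharged η Q : ℝ) - δ / 3) ≤
      (K : ℝ) ^ 3 * ((Q.motif.card : ℝ) * (Q.energyPerParticle lennardJones - eStar) + δ / 3) := by
    have hE' : interactionEnergy lennardJones (blockConfig Q K) ≤
        (Q.motif.card : ℝ) * (K : ℝ) ^ 3 * Q.energyPerParticle lennardJones +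
          (K : ℝ) ^ 3 * (δ / 3) := by
      have : (Q.motif.card : ℝ) * (K : ℝ) ^ 3 * (δ / (3 * Q.motif.card)) = (K : ℝ) ^ 3 * (δ / 3) := by
        field_simp
      nlinarith
    nlinarith
  have := le_of_mul_le_mul_left key hK3
  rw [hδ] at this
  linarith

end Blocks

/-- **`ChargedEnergyGap` is EQUIVALENT to the periodic pricing**:
`ChargedEnergyGap ↔ ∃ κ > 0, PeriodicPricing (1/100) κ`. [folklore] -/
theorem chargedEnergyGap_iff_periodicPricing :
    ChargedEnergyGap ↔ ∃ κ : ℝ, 0 < κ ∧ PeriodicPricing (1 / 100) κ := by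
  rw [chargedEnergyGap_iff_noBoundary]
  constructor
  · rintro ⟨κ, hκ, h⟩
    exact ⟨κ, hκ, Blocks.periodicPricing_of_noBoundary (by norm_num) (by norm_num) hκ.le h⟩
  · rintro ⟨κ, hκ, h⟩
    exact ⟨κ, hκ, noBoundary_of_periodicPricing (by norm_num) h⟩


end Summit.AtomisticToContinuum.Crystallization.Theorems.ChargedEnergyGapNegative

end
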